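import Summits.BirchSwinnertonDyer.BirchSwinnertonDyer.Theses.TameQuarticManinParity
import HarnessLib

/-!
# Route `TameQuarticManinParity`, LINE 21 (bsd-idea-3 g7), glue G21 `TprimeRedKodairaThreeOfKernelUnramified`
# (stmt-BirchSwinnertonDyer-27958) — PROVED BY NAME (the planner's `Sketch21-LINE21-kernel-character.lean` argument)

Cell `pub/bsd-wall`, D-0145 line `route-BirchSwinnertonDyer-TeichmullerTwistDescent`, seat `bsd-line-ttd-p1` g9,
working the planner-of-record's TQMP LINE 21. BSD is NOT proved by this; Manin's conjecture is not proved by this;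
V19 (`TprimeRedOptimalKernelUnramified`, stmt-27955), L14a (stmt-27956) and E19 (stmt-27752) stay OPEN here. This
file closes ONLY the glue: V19 ∧ L14a ∧ R3 ⇒ E19.

## Statement (verbatim the route decl)

`TprimeRedOptimalKernelUnramified → TprimeKernelUnramifiedIffKodairaThree → ReducibleModThreeHasRationalKernel →
TprimeRedOptimalIsKodairaThree`.

## Proof

Take a rational root `x₀` of `Ψ₃` (R3); V19 gives the even valuation of the kernel character at `x₀`; L14a turns
it into Kodaira type III. Pure logic. Design: theorems only; no definition, no named fact, no `sorry`; axioms
`propext`, `Classical.choice`, `Quot.sound`.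
-/

set_option autoImplicit false
-- D-0017: single-problem summit, so `Summit.BirchSwinnertonDyer.BirchSwinnertonDyer.…` repeats a namespace BY DESIGN.
set_option linter.dupNamespace false

namespace Summit.BirchSwinnertonDyer.BirchSwinnertonDyer.Theorems.TameQuarticManinParity

open Summit.BirchSwinnertonDyer.BirchSwinnertonDyer.Theses.TameQuarticManinParity

/-- **Glue G21** (stmt-BirchSwinnertonDyer-27958), by name: V19 (the optimal (t′) `3`-kernel has unramified
character) ∧ L14a (unramified kernel character ⟺ Kodaira III) ∧ R3 (reducible `W[3]` ⟹ a rational root of `Ψ₃`)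
⟹ E19 (the optimal curve is the Kodaira-III end) — the planner's
`Sketch21.tprimeRedKodairaThreeOfKernelUnramified_proof`. -/
theorem tprimeRedKodairaThreeOfKernelUnramified_proof : TprimeRedKodairaThreeOfKernelUnramified := by
  unfold TprimeRedKodairaThreeOfKernelUnramified
  intro hV hL hR W _ _ _ hcm hadd ht hred D hopt hdeg
  obtain ⟨x₀, hx⟩ := hR W hred
  exact (hL W hadd ht x₀ hx).mp (hV W hcm hadd ht hred D hopt hdeg x₀ hx)

end Summit.BirchSwinnertonDyer.BirchSwinnertonDyer.Theorems.TameQuarticManinParity
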